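import Summits.AtomisticToContinuum.BoseEinsteinCondensation.Theorems.PuffFloor.Negative.AntiCorrelatedWitness
import Summits.AtomisticToContinuum.BoseEinsteinCondensation.Theses.BECConjugateDomination
import HarnessLib

/-!
# `PuffFloor` without minimality is false (negative lemma for crux `PuffFloor`, stmt-AtomisticToContinuum-11785)

Third file of the refuter's negative-side chain for crux `PuffFloor` of route
`BECConjugateDomination` (cdisprove seat, 2026-08-16). LOAD-BEARING ANALYSIS of the crux
`∀ smooth-class v ∃ C ≥ 0 ∃ ρ₀ ∀ ρ < ρ₀ ∀ᶠ n ∀ Ψ (exact minimiser, finite energy, real, ≠ 0)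
∀ m ≠ 0: kn m / √(kn m² + Cρ) ≤ S m`:

* `PuffFloorWithoutMinimality` — the crux with the hypothesis
  `periodicEnergy v Ψ = periodicGroundStateEnergy v (n+1) L` DROPPED, everything else verbatim;
  `puffFloor_false_without_minimality : ¬ PuffFloorWithoutMinimality`. Witness: the free gas
  `v ≡ 0` is in the smooth class (`smoothClass_zero`); for every `N = n + 1 ≥ 2` the
  anti-correlated state `Ψ_{1/(2N²)}` (real, positive, finite energy) has
  `S_m = 1 - (N-1)/(2N²)` (`structureFactor_witnessState_succ`), while at the mode
  `m = (M,0,0)`, `M` large, the floor `|k|/√(|k|²+Cρ) > 1 - (N-1)/(2N²)` for EVERY `C ≥ 0` and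
  every density — so ANY proof of the crux must use the minimiser's Euler–Lagrange/spectral
  information (as the intended sum-rule proof does), not merely finite energy and positivity.
* `PuffFloorAllModes` / `puffFloorAllModes_of_puffFloor` — the guard `m ≠ 0` is decoration.
* `puffFloor_tight_at_freeGas` (with `periodicEnergy_witnessState_zero`) — for `v ≡ 0` the
  constant state is a minimiser and saturates the floor with `C = 0` at every mode
  (`kn/√(kn² + 0) = 1 = S_m`): the functional form cannot be sharpened by a uniform margin
  (Bogoliubov saturates it at every `k` with `C = 16πa`).

No Theses statement is asserted positively. All `[folklore]`.
-/

noncomputable section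

namespace Summit.AtomisticToContinuum.BoseEinsteinCondensation.Theorems.PuffFloor.Negative

open Literature.MathematicalPhysics.QuantumManyBody.BoseGas MeasureTheory Complex Finset
open scoped ComplexConjugate BigOperators ENNReal NNReal

variable {N : ℕ} {L : ℝ}

/-! ### Dropping minimality: the statement and its refutation -/

/-- `PuffFloor` with the hypothesis `periodicEnergy v Ψ = periodicGroundStateEnergy v (n+1) L`
DROPPED (everything else verbatim): the floor claimed for every finite-energy, real, pointwise
positive periodic trial state. -/
def PuffFloorWithoutMinimality : Prop :=
  ∀ v : ℝ → ENNReal, IsRepulsiveFiniteRange v → (∀ r, v r ≠ ⊤) →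
    ContDiff ℝ 2 (fun x : Space => (v ‖x‖).toReal) →
    (∃ Cₑ : ℝ, ∀ x : Space, ‖iteratedFDeriv ℝ 2 (fun x : Space => (v ‖x‖).toReal) x‖ ≤
      Cₑ * Real.sqrt ((v ‖x‖).toReal)) →
    ∃ C : ℝ, 0 ≤ C ∧ ∃ ρ₀ : ℝ, 0 < ρ₀ ∧ ∀ ρ : ℝ, 0 < ρ → ρ < ρ₀ →
      ∀ᶠ n : ℕ in Filter.atTop, ∀ Ψ : PeriodicTrialState (n + 1) (sideLength ρ (n + 1)),
        (let L : ℝ := sideLength ρ (n + 1)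
         let S : (Fin 3 → ℤ) → ℝ := fun m => ((n : ℝ) + 1)⁻¹ *
           ∫ X in cellN (n + 1) L, ‖∑ j : Fin (n + 1), cellWave L m (X j)‖ ^ 2 * ‖Ψ.ψ X‖ ^ 2
         let kn : (Fin 3 → ℤ) → ℝ := fun m => ‖((2 * Real.pi / L) • latticeVec 1 m)‖
         periodicEnergy v Ψ ≠ ⊤ → (∀ X, Ψ.ψ X = (‖Ψ.ψ X‖ : ℂ)) → (∀ X, Ψ.ψ X ≠ 0) →
           ∀ m : Fin 3 → ℤ, m ≠ 0 → kn m / Real.sqrt (kn m ^ 2 + C * ρ) ≤ S m)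

/-- The free gas `v ≡ 0` belongs to the smooth class. [folklore] -/
theorem smoothClass_zero :
    IsRepulsiveFiniteRange (0 : ℝ → ℝ≥0∞) ∧ (∀ r, (0 : ℝ → ℝ≥0∞) r ≠ ⊤) ∧
      ContDiff ℝ 2 (fun x : Space => ((0 : ℝ → ℝ≥0∞) ‖x‖).toReal) ∧
      (∃ Cₑ : ℝ, ∀ x : Space,
        ‖iteratedFDeriv ℝ 2 (fun x : Space => ((0 : ℝ → ℝ≥0∞) ‖x‖).toReal) x‖ ≤
          Cₑ * Real.sqrt (((0 : ℝ → ℝ≥0∞) ‖x‖).toReal)) := by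
  have hf : (fun x : Space => ((0 : ℝ → ℝ≥0∞) ‖x‖).toReal) = fun _ => (0 : ℝ) := by
    funext x; simp
  refine ⟨⟨measurable_const, 0, fun r _ => rfl⟩, fun r => ENNReal.zero_ne_top, ?_, ⟨0, fun x => ?_⟩⟩
  · rw [hf]; exact contDiff_const
  · rw [hf, iteratedFDeriv_fun_zero]; simp

/-- Every periodic trial state of the free gas has finite energy. [folklore] -/
theorem periodicEnergy_zero_ne_top (Ψ : PeriodicTrialState N L) :
    periodicEnergy (0 : ℝ → ℝ≥0∞) Ψ ≠ ⊤ := by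
  have hW : ∫⁻ X in cellN N L, periodicInteraction (0 : ℝ → ℝ≥0∞) L X ≠ ⊤ := by
    simp_rw [periodicInteraction_zeroPotential]
    simp
  exact (lintegral_energy_lt_top measurable_const hW Ψ.contDiff).ne

/-- `|c · (M e₀)| = c M` for the lattice vector `(M, 0, 0)`. [folklore] -/
theorem norm_smul_latticeVec_single {c : ℝ} (hc : 0 ≤ c) (M : ℕ) :
    ‖c • latticeVec 1 (Pi.single (0 : Fin 3) (M : ℤ))‖ = c * M := by
  rw [norm_smul, Real.norm_of_nonneg hc]
  congr 1
  rw [EuclideanSpace.norm_eq, Fin.sum_univ_three]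
  simp [latticeVec, Pi.single_apply]

/-- The admissible amplitude `ε = 1/(2N²)`: `ε(N² - N) ≤ ½`. [folklore] -/
theorem eps_admissible (N : ℕ) : (2 * (N : ℝ) ^ 2)⁻¹ * ((N : ℝ) ^ 2 - N) ≤ 1 / 2 := by
  rcases Nat.eq_zero_or_pos N with rfl | hN
  · simp
  · have hN' : (0 : ℝ) < N := by exact_mod_cast hN
    rw [inv_mul_le_iff₀ (by positivity)]
    nlinarith

/-- `S_m` of the witness with `ε = 1/(2N²)` in the syntactic form of the crux (`N = n + 1`):
`S_m = 1 - n / (2(n+1)²)`. [folklore] -/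
theorem structureFactor_witnessState_succ (hL : 0 < L) (n : ℕ) {m : Fin 3 → ℤ} (hm : m ≠ 0) :
    ((n : ℝ) + 1)⁻¹ * ∫ X in cellN (n + 1) L,
        ‖∑ j : Fin (n + 1), cellWave L m (X j)‖ ^ 2 *
          ‖(witnessState (N := n + 1) (ε := (2 * ((n : ℝ) + 1) ^ 2)⁻¹) (by positivity)
            (by exact_mod_cast eps_admissible (n + 1)) hL hm).ψ X‖ ^ 2 =
      1 - (n : ℝ) / (2 * ((n : ℝ) + 1) ^ 2) := by
  have h := structureFactor_witnessState (N := n + 1) (ε := (2 * ((n : ℝ) + 1) ^ 2)⁻¹)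
    (by positivity) (by exact_mod_cast eps_admissible (n + 1)) hL (Nat.succ_pos n) hm
  push_cast at h
  rw [add_sub_cancel_right] at h
  rw [h]
  ring

/-- **Minimality is load-bearing.** `PuffFloor` with the minimiser hypothesis dropped is FALSE:
for the free gas `v ≡ 0` (in the smooth class) and every `N ≥ 2`, the real, positive, finite-energy
state `Ψ_N ∝ √(1 - (|ρ_m|² - N)/(2N²))` has `S_m = 1 - (N-1)/(2N²)`, while the floor at a mode
`m = (M, 0, 0)` with `M` large is `> 1 - (N-1)/(2N²)` — for every `C ≥ 0` and every density. -/
theorem puffFloor_false_without_minimality : ¬ PuffFloorWithoutMinimality := by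
  intro h
  obtain ⟨h1, h2, h3, h4⟩ := smoothClass_zero
  obtain ⟨C, hC, ρ₀, hρ₀, h⟩ := h 0 h1 h2 h3 h4
  set ρ : ℝ := ρ₀ / 2 with hρdef
  have hρ : 0 < ρ := by positivity
  have hev := h ρ hρ (by rw [hρdef]; linarith)
  rw [Filter.eventually_atTop] at hev
  obtain ⟨n₀, hn₀⟩ := hev
  set n : ℕ := max n₀ 1 with hndef
  have h1n : 1 ≤ n := le_max_right _ _
  have key := hn₀ n (le_max_left _ _)
  set L : ℝ := sideLength ρ (n + 1) with hLdef
  have hL : 0 < L := Real.rpow_pos_of_pos (by positivity) _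
  -- the deficit of the witness and the mode
  set δ : ℝ := (n : ℝ) / (2 * ((n : ℝ) + 1) ^ 2) with hδdef
  have hn' : (1 : ℝ) ≤ n := by exact_mod_cast h1n
  have hδ0 : 0 < δ := by positivity
  have hδ1 : δ < 1 := by
    rw [hδdef, div_lt_one (by positivity)]
    nlinarith
  have hcL : 0 < 2 * Real.pi / L := by positivity
  obtain ⟨M, hM⟩ := exists_nat_gt (C * ρ / ((2 * Real.pi / L) ^ 2 * δ))
  set m : Fin 3 → ℤ := Pi.single (0 : Fin 3) ((M + 1 : ℕ) : ℤ) with hmdef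
  have hm : m ≠ 0 := by
    intro h0
    have := congr_fun h0 0
    rw [hmdef, Pi.single_eq_same, Pi.zero_apply] at this
    exact absurd this (by exact_mod_cast Nat.succ_ne_zero M)
  have hkn : ‖((2 * Real.pi / L) • latticeVec 1 m)‖ = (2 * Real.pi / L) * (M + 1 : ℕ) :=
    norm_smul_latticeVec_single hcL.le (M + 1)
  set k : ℝ := (2 * Real.pi / L) * (M + 1 : ℕ) with hkdef
  have hk : 0 < k := by positivity
  -- `C ρ < k² δ`
  have hCρ : C * ρ < k ^ 2 * δ := by
    have hq : C * ρ / ((2 * Real.pi / L) ^ 2 * δ) < (M + 1 : ℕ) :=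
      hM.trans (by exact_mod_cast Nat.lt_succ_self M)
    rw [div_lt_iff₀ (by positivity)] at hq
    have hM1 : (1 : ℝ) ≤ (M + 1 : ℕ) := by exact_mod_cast Nat.succ_le_succ (Nat.zero_le M)
    calc C * ρ < (M + 1 : ℕ) * ((2 * Real.pi / L) ^ 2 * δ) := hq
      _ ≤ (M + 1 : ℕ) * ((2 * Real.pi / L) ^ 2 * δ) * (M + 1 : ℕ) :=
          le_mul_of_one_le_right (by positivity) hM1
      _ = k ^ 2 * δ := by rw [hkdef]; ring
  -- evaluate the crux inequality on the witness
  have hεa : (2 * ((n : ℝ) + 1) ^ 2)⁻¹ * ((((n + 1 : ℕ) : ℝ)) ^ 2 - ((n + 1 : ℕ) : ℝ)) ≤ 1 / 2 := by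
    have h := eps_admissible (n + 1)
    push_cast at h ⊢
    exact h
  have hε0 : (0 : ℝ) ≤ (2 * ((n : ℝ) + 1) ^ 2)⁻¹ := by positivity
  have hw := key (witnessState hε0 hεa hL hm) (periodicEnergy_zero_ne_top _)
    (witnessState_real hε0 hεa hL hm) (witnessState_ne_zero hε0 hεa hL hm) m hm
  dsimp only at hw
  rw [structureFactor_witnessState_succ hL n hm, hkn, ← hδdef] at hw
  -- `k/√(k² + Cρ) ≤ 1 - δ` contradicts `Cρ < k²δ`
  clear_value k δ
  have hsq : 0 < Real.sqrt (k ^ 2 + C * ρ) := Real.sqrt_pos.2 (by positivity)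
  rw [div_le_iff₀ hsq] at hw
  have h3 : k ^ 2 ≤ ((1 - δ) * Real.sqrt (k ^ 2 + C * ρ)) ^ 2 :=
    pow_le_pow_left₀ hk.le hw 2
  rw [mul_pow, Real.sq_sqrt (by positivity)] at h3
  have h4 : k ^ 2 * δ * (2 - δ) ≤ C * ρ := by nlinarith
  have h5 : 0 < k ^ 2 * δ * (1 - δ) := mul_pos (mul_pos (pow_pos hk 2) hδ0) (by linarith)
  nlinarith [h4, h5, hCρ]


/-! ### Decoration: the guard `m ≠ 0` is unnecessary -/

/-- `PuffFloor` with the guard `m ≠ 0` REMOVED (the floor claimed at every lattice mode,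
including `m = 0` where `kn 0 = 0`). -/
def PuffFloorAllModes : Prop :=
  ∀ v : ℝ → ENNReal, IsRepulsiveFiniteRange v → (∀ r, v r ≠ ⊤) →
    ContDiff ℝ 2 (fun x : Space => (v ‖x‖).toReal) →
    (∃ Cₑ : ℝ, ∀ x : Space, ‖iteratedFDeriv ℝ 2 (fun x : Space => (v ‖x‖).toReal) x‖ ≤
      Cₑ * Real.sqrt ((v ‖x‖).toReal)) →
    ∃ C : ℝ, 0 ≤ C ∧ ∃ ρ₀ : ℝ, 0 < ρ₀ ∧ ∀ ρ : ℝ, 0 < ρ → ρ < ρ₀ →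
      ∀ᶠ n : ℕ in Filter.atTop, ∀ Ψ : PeriodicTrialState (n + 1) (sideLength ρ (n + 1)),
        (let L : ℝ := sideLength ρ (n + 1)
         let S : (Fin 3 → ℤ) → ℝ := fun m => ((n : ℝ) + 1)⁻¹ *
           ∫ X in cellN (n + 1) L, ‖∑ j : Fin (n + 1), cellWave L m (X j)‖ ^ 2 * ‖Ψ.ψ X‖ ^ 2
         let kn : (Fin 3 → ℤ) → ℝ := fun m => ‖((2 * Real.pi / L) • latticeVec 1 m)‖
         periodicEnergy v Ψ = periodicGroundStateEnergy v (n + 1) L → periodicEnergy v Ψ ≠ ⊤ →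
           (∀ X, Ψ.ψ X = (‖Ψ.ψ X‖ : ℂ)) → (∀ X, Ψ.ψ X ≠ 0) →
           ∀ m : Fin 3 → ℤ, kn m / Real.sqrt (kn m ^ 2 + C * ρ) ≤ S m)

/-- **`m ≠ 0` is decoration**: `PuffFloor` implies the guard-free form `PuffFloorAllModes`
(at `m = 0` the floor reads `0 ≤ S 0`, which always holds: `kn 0 = 0`, `S 0 ≥ 0`); the converse
is instantiation, so the two are equivalent and a prover may ignore the guard. [folklore] -/
theorem puffFloorAllModes_of_puffFloor
    (h : Summit.AtomisticToContinuum.BoseEinsteinCondensation.Theses.BECConjugateDomination.PuffFloor) :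
    PuffFloorAllModes := by
  intro v h1 h2 h3 h4
  obtain ⟨C, hC, ρ₀, hρ₀, h⟩ := h v h1 h2 h3 h4
  refine ⟨C, hC, ρ₀, hρ₀, fun ρ hρ hρ' => ?_⟩
  filter_upwards [h ρ hρ hρ'] with n hn Ψ
  intro L S kn hE hfin hre hne m
  by_cases hm : m = 0
  · subst hm
    simp only [kn, S]
    rw [latticeVec_zero, smul_zero, norm_zero, zero_div]
    exact mul_nonneg (by positivity) (integral_nonneg fun X => by positivity)
  · exact hn Ψ hE hfin hre hne m hm

/-! ### Tightness: the free gas saturates the floor with `C = 0` at every mode -/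

/-- `latticeVec 1 m ≠ 0` for `m ≠ 0`, hence `kn m > 0`. [folklore] -/
theorem norm_latticeVec_one_pos {m : Fin 3 → ℤ} (hm : m ≠ 0) : 0 < ‖latticeVec 1 m‖ := by
  rw [norm_pos_iff]
  intro h
  apply hm
  funext k
  simpa [latticeVec] using congr_arg (fun x : Space => x k) h

/-- The constant state is the witness with `ε = 0`; it is a minimiser of the free gas
(`periodicEnergy 0 = 0 = E₀^per`). [folklore] -/
theorem periodicEnergy_witnessState_zero (hL : 0 < L) {m : Fin 3 → ℤ} (hm : m ≠ 0) :
    periodicEnergy (0 : ℝ → ℝ≥0∞) (witnessState (N := N) (ε := 0) le_rfl (by simp) hL hm) =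
      periodicGroundStateEnergy (0 : ℝ → ℝ≥0∞) N L := by
  have hconst : (witnessState (N := N) (ε := (0 : ℝ)) le_rfl (by simp) hL hm).ψ =
      fun _ => ((Real.sqrt ((L ^ 3) ^ N))⁻¹ : ℂ) := by
    funext X
    rw [witnessState_apply, witnessFun, witnessDensity, zero_mul, sub_zero, Real.sqrt_one,
      Complex.ofReal_one, mul_one]
  generalize witnessState (N := N) (ε := (0 : ℝ)) le_rfl (by simp) hL hm = Ψ at hconst ⊢
  rw [periodicGroundStateEnergy_zero_eq_zero N hL, periodicEnergy]
  refine (lintegral_congr fun X => ?_).trans lintegral_zero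
  rw [periodicInteraction_zeroPotential, zero_mul, add_zero]
  simp [kineticDensity, hconst]

/-- **Tightness at the free gas.** For `v ≡ 0` and the constant minimiser the crux's inequality
holds with EQUALITY at `C = 0` and every mode `m ≠ 0`: `kn m / √(kn m² + 0·ρ) = 1 = S_m`. So the
floor `|k|/√(|k|² + Cρ) ≤ S` cannot be sharpened by any uniform positive margin, and `C(v) → 0` as
`v → 0` is consistent (Bogoliubov: `C = 16πa`). [folklore] -/
theorem puffFloor_tight_at_freeGas (hL : 0 < L) (hN : 0 < N) {m : Fin 3 → ℤ} (hm : m ≠ 0) (ρ : ℝ) :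
    ‖((2 * Real.pi / L) • latticeVec 1 m)‖ /
        Real.sqrt (‖((2 * Real.pi / L) • latticeVec 1 m)‖ ^ 2 + 0 * ρ) =
      (N : ℝ)⁻¹ * ∫ X in cellN N L, ‖∑ j : Fin N, cellWave L m (X j)‖ ^ 2 *
        ‖(witnessState (N := N) (ε := 0) le_rfl (by simp) hL hm).ψ X‖ ^ 2 := by
  have hk : 0 < ‖((2 * Real.pi / L) • latticeVec 1 m)‖ := by
    rw [norm_smul]
    exact mul_pos (by rw [Real.norm_eq_abs, abs_pos]; positivity) (norm_latticeVec_one_pos hm)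
  rw [zero_mul, add_zero, Real.sqrt_sq hk.le, div_self hk.ne',
    structureFactor_witnessState le_rfl (by simp) hL hN hm, zero_mul, sub_zero]


end Summit.AtomisticToContinuum.BoseEinsteinCondensation.Theorems.PuffFloor.Negative

end
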